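import Summits.HodgeConjecture.HodgeConjecture.Theorems.CyclicUnitaryPowersCyclicSurfacePowersHodgeOffMeagre
import Literature.AlgebraicGeometry.HodgeTheory.HypersurfaceFamilyTopFormFramesChart
import Literature.AlgebraicGeometry.HodgeTheory.HodgeLociAnalyticCoverOfWeightTwoFrames
import Literature.AlgebraicGeometry.HodgeTheory.HypersurfaceFamilyCoordinates
import Literature.AlgebraicGeometry.Motives.HodgeNumberFamilySemicontinuity
import Literature.Analysis.Calculus.RealAnalyticZeroSetAddHaar
import Mathlib.MeasureTheory.Function.Jacobian
import Mathlib.LinearAlgebra.Complex.FiniteDimensional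
import HarnessLib

/-!
# Route CyclicUnitaryPowers — the analytic K1-A and the analytic rung leaf hold ALMOST EVERYWHERE:
# off a set of coefficient vectors that is both MEAGRE and LEBESGUE-NULL (a countable union of local analytic
# hypersurfaces read in algebraic charts), UNCONDITIONALLY

Support file for `stmt-HodgeConjecture-19544` (`--supports`; nothing here closes an item). Prover seat
`hodge-nonav-prover-Ax` (g13, cell hodge-nonav), leaf of programme «AE» («almost every»).

`CyclicUnitaryPowersCyclicSurfacePowersHodgeOffMeagre` (20241-p1 g17, programme B4 of this seat) proved, with NO named
fact, the clauses `Deck ∧ Comm` of crux K1-A and `HodgeConjectureFor (2(k+1)) Y` for all self fibre powers `Y` of EVERY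
smooth projective surface `X ⊂ ℙ³` cut out by `x₃^p − f` (`p ≥ 7` prime) with `f` off a MEAGRE subset of the coefficient
space `ℂ^{TernaryIndex p}` — the «complement of a meager subset» of Deligne 1972 Prop. 7.5 ∕ André 1992 Lemma 4. A
meagre set can have full Lebesgue measure; the standard analytic «very general» is sharper: the exceptional set lies in
a countable union of proper local ANALYTIC HYPERSURFACES (Voisin II Lemma 5.13: the Hodge loci are analytic subsets),
hence is ALSO Lebesgue-null. This file proves that sharper form, still with no named fact:

* `volume_image_zeroSet_eq_zero` — measure theory: a differentiable image (in a space of the same real dimension) of the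
  zero set of a non-trivial real-analytic function on a connected open set is Lebesgue-null (the tree's
  `addHaar_zeroSet_eq_zero_of_analyticOnNhd_complex` [Mityagin] + Mathlib's
  `addHaar_image_eq_zero_of_differentiableOn_of_addHaar_eq_zero`).
* `differentiableOn_coeffChart_comp_algebraicChart_symm` — GAGA: the coefficient chart `t ↦ (coeff_e f_t)_e` of the
  Carlson–Toledo base `S(ℂ)` is holomorphic in every algebraic chart (`mdifferentiable_affineCoords_map_comp`).
* §1 `exists_nullMeagre_isHodgeGenericPoint_cyclicCoverFamily` — for `p ≥ 4` and Hodge-symmetric fibre models, a set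
  `M ⊆ ℂ^{TernaryIndex p}`, MEAGRE and of `volume` ZERO, containing `0`, off which the classifying point of every `f` with
  smooth cyclic model is Hodge generic: the countable analytic cover
  `exists_countable_analyticCover_isHodgeGenericPoint_of_weightTwoFrames` fed with the frames of
  `exists_topFormFrame_familySpz_chartAt` (Griffiths residues, read in the ALGEBRAIC chart), pushed to the coefficient
  space by the coefficient chart (an embedding, `isEmbedding_coeffChart`; differentiable in algebraic charts).
* §2 `exists_deck_comm_ae` — analytic K1-A almost everywhere: `∃ M, IsMeagre M ∧ volume M = 0 ∧ …Deck ∧ Comm…`.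
* §3 `cyclicSurfacePowersHodge_ae` — the analytic leaf almost everywhere: for every prime `p ≥ 7` a set `M` of
  coefficient vectors with `volume M = 0` and `M` meagre such that for every `f` homogeneous of degree `p` off `M`, every
  smooth projective `X ⊂ ℙ³` cut out by `x₃^p − f` and every `(k+1)`-fold self fibre power `Y` of `X`:
  `HodgeConjectureFor (2(k+1)) Y` — NO hypothesis, axioms standard.

HONEST FRAMING: this is the Hodge conjecture for all powers of Lebesgue-almost-every (and comeagre-many) `p`-cyclic
surfaces, every prime `p ≥ 7`; the exceptional set is NOT shown to lie in a countable union of proper Zariski-closed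
subsets (that is Cattani–Deligne–Kaplan, print item 23152), so items 19544 ∕ 19543 stay OPEN; rung F-H1 is not moved;
nothing here says HC ∕ HC_CM ∕ HC_AV is proved.

## References
* [Deligne1972WeilK3] P. Deligne, La conjecture de Weil pour les surfaces K3, Invent. Math. 15 (1972), Prop. 7.5.
* [Andre1992] Y. André, Mumford–Tate groups of mixed Hodge structures …, Compositio Math. 82 (1992), §4 Lemma 4, §5 Thm. 1.
* [VoisinHodgeII2003] C. Voisin, Hodge Theory and Complex Algebraic Geometry II, CUP 2003, §5.3.1 Lemma 5.13, §6.1.3, §6.2.1.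
* [Griffiths1968PeriodsII] P. Griffiths, Periods of integrals on algebraic manifolds II, Amer. J. Math. 90 (1968), Thm. 1.1.
* [CarlsonToledo1999] J. A. Carlson, D. Toledo, Duke Math. J. 97 (1999), §§2, 5, 6, 7 (Thm. 7.1).
* [SerreGAGA1956] J.-P. Serre, Géométrie algébrique et géométrie analytique, §2 n°5.
* [Mityagin2015] B. Mityagin, The zero set of a real analytic function, arXiv:1512.07276, Prop. 1.
-/

noncomputable section

set_option linter.dupNamespace false

namespace Summit.HodgeConjecture.HodgeConjecture.Theorems.CyclicUnitaryPowersGenericCyclicSurfacePowersHodge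

open scoped Manifold ContDiff Topology TensorProduct
open MeasureTheory Set Module
open CategoryTheory CategoryTheory.Limits AlgebraicGeometry
open _root_.Topology _root_.Filter
open Literature.NumberTheory.Transcendental Literature.AlgebraicGeometry.Motives Literature.AlgebraicGeometry.HodgeTheory
open Literature.AlgebraicGeometry.HodgeTheory.BettiUniverse
open Literature.AlgebraicGeometry.Motives.UniversalHypersurface Literature.AlgebraicGeometry.HodgeTheory.UniversalHypersurface
open Literature.AlgebraicTopology.SingularHomology
open Summit.HodgeConjecture.HodgeConjecture.Theorems.CyclicUnitaryPowersHodgeGenericDeckCommutators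
open Summit.HodgeConjecture.HodgeConjecture.Theorems.CyclicUnitaryPowersNodalMeridianMonodromy

/-! ### §0 Two lemmas: null images of analytic zero sets; the coefficient chart is holomorphic in algebraic charts -/

/-- **A differentiable image of the zero set of a non-trivial holomorphic function is Lebesgue-null** (in a
target of the same real dimension): for `U ⊆ ℂᵐ` open and connected, `g` real-analytic on `U` with `g z ≠ 0`
somewhere on `U`, and `F : ℂᵐ → ℂ^T` differentiable on `U` with `2·|T| = 2·m`, the image
`F '' {z ∈ U | g z = 0}` has `volume` zero (the zero set is null for every additive Haar measure — the tree's
`addHaar_zeroSet_eq_zero_of_analyticOnNhd_complex` — and differentiable self-maps send null sets to null sets,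
`addHaar_image_eq_zero_of_differentiableOn_of_addHaar_eq_zero`, after a linear identification `ℂ^T ≃ ℂᵐ`). -/
theorem volume_image_zeroSet_eq_zero {m : ℕ} {T : Type} [Fintype T]
    (hcard : Fintype.card T = m) {U : Set (Fin m → ℂ)} (hU : IsOpen U) (hUc : IsConnected U)
    {g : (Fin m → ℂ) → ℂ} (hg : AnalyticOnNhd ℝ g U) (hne : ∃ z ∈ U, g z ≠ 0)
    {F : (Fin m → ℂ) → (T → ℂ)} (hF : DifferentiableOn ℝ F U) :
    volume (F '' {z ∈ U | g z = 0}) = 0 := by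
  -- a real-linear identification `L : ℂ^T ≃ ℂᵐ`
  have hfin : Module.finrank ℝ (T → ℂ) = Module.finrank ℝ (Fin m → ℂ) := by
    rw [finrank_real_of_complex, finrank_real_of_complex, Module.finrank_fintype_fun_eq_card,
      Module.finrank_fintype_fun_eq_card, Fintype.card_fin, hcard]
  let L : (T → ℂ) ≃L[ℝ] (Fin m → ℂ) := ContinuousLinearEquiv.ofFinrankEq hfin
  -- the add-Haar measure `η := L_* vol` on `ℂᵐ`
  let η : Measure (Fin m → ℂ) := Measure.map L volume
  haveI : η.IsAddHaarMeasure := L.isAddHaarMeasure_map _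
  have hA : η {z ∈ U | g z = 0} = 0 :=
    Literature.Analysis.Calculus.addHaar_zeroSet_eq_zero_of_analyticOnNhd_complex η hU hUc hg hne
  have hLF : DifferentiableOn ℝ (L ∘ F) {z ∈ U | g z = 0} :=
    (L.differentiable.comp_differentiableOn hF).mono fun z hz ↦ hz.1
  have hB : η ((L ∘ F) '' {z ∈ U | g z = 0}) = 0 :=
    addHaar_image_eq_zero_of_differentiableOn_of_addHaar_eq_zero η hLF hA
  -- pull back along `L`
  have hset : F '' {z ∈ U | g z = 0} = L ⁻¹' ((L ∘ F) '' {z ∈ U | g z = 0}) := by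
    rw [Set.image_comp, L.injective.preimage_image]
  have hmap : η ((L ∘ F) '' {z ∈ U | g z = 0}) = volume (L ⁻¹' ((L ∘ F) '' {z ∈ U | g z = 0})) := by
    have h := L.toHomeomorph.toMeasurableEquiv.map_apply (μ := volume) ((L ∘ F) '' {z ∈ U | g z = 0})
    simp only [Homeomorph.toMeasurableEquiv_coe, ContinuousLinearEquiv.coe_toHomeomorph] at h
    exact h
  rw [hset, ← hmap]
  exact hB


/-- **The coefficient chart of the Carlson–Toledo base is holomorphic in every algebraic chart** (Serre, GAGA §2:
regular functions are holomorphic): for every point `t₁` of `S(ℂ)`, the map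
`z ↦ (coeff_e f_{(algebraicChart S m t₁)⁻¹ z})_e` is `ℂ`-differentiable on the target of the algebraic chart at `t₁`
(each coefficient is, up to sign, an affine coordinate of `S ↪ U → 𝔸^{DegIndex 2 p}`,
`mdifferentiable_affineCoords_map_comp` on the analytification `id : S(ℂ) → S(ℂ)`). -/
theorem differentiableOn_coeffChart_comp_algebraicChart_symm (p m : ℕ) [NeZero p]
    [LocallyOfFiniteType (cyclicCoverBase p).hom] [SmoothOfRelativeDimension m (cyclicCoverBase p).hom]
    (t₁ : ComplexPoints (cyclicCoverBase p)) :
    DifferentiableOn ℂ (fun z ↦ fun e : TernaryIndex p ↦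
        (branchForm p ((ComplexPoints.algebraicChart (cyclicCoverBase p) m t₁).symm z)).coeff e.1)
      (ComplexPoints.algebraicChart (cyclicCoverBase p) m t₁).target := by
  letI cs : ChartedSpace (Fin m → ℂ) (ComplexPoints (cyclicCoverBase p)) :=
    chartedSpaceOfCharts (ComplexPoints.algebraicChart (cyclicCoverBase p) m)
      (ComplexPoints.mem_algebraicChart_source _ m)
  haveI : IsManifold 𝓘(ℂ, Fin m → ℂ) ω (ComplexPoints (cyclicCoverBase p)) :=
    isManifold_algebraicChart _ m
  refine differentiableOn_pi.2 fun e ↦ ?_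
  -- the coefficient as (minus) an affine coordinate of `S → U → 𝔸`
  set g := toBaseSpz ℂ 2 p (cyclicCoverSpz p) ≫ baseToAffineSpace ℂ 2 p with hg
  have hfun : ∀ t : ComplexPoints (cyclicCoverBase p), (branchForm p t).coeff e.1 =
      -AlgPoints.affineCoords (AlgPoints.map g t) (extendIndex e) := by
    intro t
    have h1 : AlgPoints.affineCoords (AlgPoints.map g t) (extendIndex e) =
        coeffVector ℂ 2 p (AlgPoints.map (toBaseSpz ℂ 2 p (cyclicCoverSpz p)) t) (extendIndex e) := by
      rw [hg, AlgPoints.map_comp_apply, coeffVector_eq_comp]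
      rfl
    rw [h1, coeffVector_apply, coeff_pointFormSpz, cyclicCoverSpz_X_extendIndex p (NeZero.ne p), map_neg,
      neg_neg, coeffChart_apply, pointAlgHomSpz_apply]
  -- holomorphy on the manifold `S(ℂ)` (GAGA), read in the chart at `t₁`
  have hmd : MDifferentiable 𝓘(ℂ, Fin m → ℂ) 𝓘(ℂ, ℂ)
      (fun t : ComplexPoints (cyclicCoverBase p) ↦ AlgPoints.affineCoords (AlgPoints.map g (id t)) (extendIndex e)) :=
    mdifferentiable_affineCoords_map_comp g (isAnalytification_algebraicChart (X := cyclicCoverBase p) (e := m))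
      (extendIndex e)
  intro z hz
  set c := ComplexPoints.algebraicChart (cyclicCoverBase p) m t₁ with hc
  have hx' : c.symm z ∈ (chartAt (Fin m → ℂ) t₁).source := c.map_target hz
  have h := (mdifferentiableAt_iff_of_mem_source (I := 𝓘(ℂ, Fin m → ℂ)) (I' := 𝓘(ℂ, ℂ))
    (x := t₁) (y := AlgPoints.affineCoords (AlgPoints.map g (id (c.symm z))) (extendIndex e)) hx'
    (mem_chart_source ℂ _)).1 (hmd (c.symm z))
  obtain ⟨-, hd⟩ := h
  rw [extChartAt_self_eq, modelWithCornersSelf_coe, Function.id_comp, ModelWithCorners.range_eq_univ] at hd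
  have hz' : extChartAt 𝓘(ℂ, Fin m → ℂ) t₁ (c.symm z) = z := by
    rw [extChartAt_coe, modelWithCornersSelf_coe, Function.id_comp]
    exact c.right_inv hz
  rw [hz'] at hd
  have hd' : DifferentiableAt ℂ (fun w ↦ AlgPoints.affineCoords (AlgPoints.map g (c.symm w)) (extendIndex e)) z := by
    have := hd.differentiableAt Filter.univ_mem
    refine this.congr_of_eventuallyEq (Filter.Eventually.of_forall fun w ↦ ?_)
    simp only [Function.comp_apply, id_eq, extChartAt_coe_symm, modelWithCornersSelf_coe_symm, Function.comp_id]
    rfl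
  have heq : (fun w ↦ (branchForm p (c.symm w)).coeff e.1) =
      fun w ↦ -AlgPoints.affineCoords (AlgPoints.map g (c.symm w)) (extendIndex e) := funext fun w ↦ hfun _
  rw [heq]
  exact hd'.neg.differentiableWithinAt


/-! ### §1 The meagre AND null exceptional set of coefficient vectors — unconditional -/

/-- **The exceptional set of the Carlson–Toledo family is meagre and Lebesgue-null, unconditionally** (§1): for `p ≥ 4`
and Hodge-symmetric fibre models `A`, there is `M ⊆ ℂ^{TernaryIndex p}`, MEAGRE and with `volume M = 0`, containing `0`,
off which the classifying point of every `f` with smooth cyclic model is Hodge generic. `M` is `{0}` together with the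
images, under the coefficient chart, of the countably many local analytic hypersurfaces `{t ∈ W | g (ψ t) = 0}` of
`exists_countable_analyticCover_isHodgeGenericPoint_of_weightTwoFrames` — `ψ` an ALGEBRAIC chart by
`exists_topFormFrame_familySpz_chartAt` — each nowhere dense (so `M` is meagre, the chart being an embedding) and each
mapped into `volume`-null sets (`volume_image_zeroSet_eq_zero` with `differentiableOn_coeffChart_comp_algebraicChart_symm`).
[cite: Deligne1972WeilK3, Prop. 7.5] [cite: VoisinHodgeII2003, §5.3.1 Lemma 5.13] [cite: Griffiths1968PeriodsII, Thm. 1.1]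
[cite: CarlsonToledo1999, §2] [cite: SerreGAGA1956, §2 n°5 Prop. 2] -/
theorem exists_nullMeagre_isHodgeGenericPoint_cyclicCoverFamily (p : ℕ) [NeZero p] (hp : 4 ≤ p)
    (A : ∀ t : ComplexPoints (cyclicCoverBase p), HodgeModel 2 (fiberOver (cyclicCoverFamily p) t))
    (hA : ∀ t, (A t).IsHodgeSymmetric) :
    ∃ M : Set (TernaryIndex p → ℂ), IsMeagre M ∧ volume M = 0 ∧ (0 : TernaryIndex p → ℂ) ∈ M ∧
      ∀ f : MvPolynomial (Fin 3) ℂ, f.IsHomogeneous p →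
        SmoothHypersurface.IsNonsingularForm ℂ (cyclicCoverForm p f) →
        (fun d : TernaryIndex p => f.coeff d.1) ∉ M →
        haveI : HodgeTensorFacts.{0, 0} := hodgeTensorFacts_holds
        haveI : ∀ t : ComplexPoints (cyclicCoverBase p),
            Module.Finite ℚ (bettiCohomology (fiberOver (cyclicCoverFamily p) t) 2) :=
          fun t => finite ((isSmoothProjectiveFamily_cyclicCoverFamily p).isSmoothProjective t) 2
        IsHodgeGenericPoint (cyclicCoverFamily p) 2 (cyclicCoverFamily_locallyTrivial p)
          (isSmoothProjectiveFamily_cyclicCoverFamily p) A hA ⟨cyclicCoverPoint p f, Set.mem_univ _⟩ := by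
  classical
  haveI : HodgeTensorFacts.{0, 0} := hodgeTensorFacts_holds
  haveI : ∀ t : ComplexPoints (cyclicCoverBase p),
      Module.Finite ℚ (bettiCohomology (fiberOver (cyclicCoverFamily p) t) 2) :=
    fun t => finite ((isSmoothProjectiveFamily_cyclicCoverFamily p).isSmoothProjective t) 2
  haveI := smoothOfRelativeDimension_baseSpz_hom ℂ 2 p (cyclicCoverSpz p)
  haveI : LocallyOfFiniteType (cyclicCoverBase p).hom := locallyOfFiniteType_baseSpz_hom ℂ 2 p (cyclicCoverSpz p)
  -- notation
  set S := cyclicCoverBase p with hSdef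
  set m : ℕ := 0 + Nat.card (TernaryIndex p) with hmdef
  -- the «Good» charts: algebraic charts at some point
  let Good : OpenPartialHomeomorph (Set.univ : Set (ComplexPoints S)) (Fin m → ℂ) → Prop := fun ψ ↦
    ∃ t₁ : ComplexPoints S, (∀ t, (ψ t : Fin m → ℂ) = ComplexPoints.algebraicChart S m t₁ t.1) ∧
      (∀ t, t ∈ ψ.source ↔ t.1 ∈ (ComplexPoints.algebraicChart S m t₁).source) ∧
      (∀ z, ((ψ.symm z : (Set.univ : Set (ComplexPoints S))) : ComplexPoints S) =
        (ComplexPoints.algebraicChart S m t₁).symm z)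
  -- the countable analytic cover of the non-generic points, in Good charts
  obtain ⟨𝒞, h𝒞c, h𝒞s, hgen⟩ := exists_countable_analyticCover_isHodgeGenericPoint_of_weightTwoFrames
    (cyclicCoverFamily p) m (isSmoothProjectiveFamily_cyclicCoverFamily p)
    (isQuasiProjectiveOver_baseSpz 2 p (cyclicCoverSpz p)) (cyclicCoverFamily_locallyTrivial p) A hA
    (show 1 ≤ 2 + 1 by norm_num)
    (totalSpzToTotal ℂ 2 p (cyclicCoverSpz p) ≫ toProjectiveSpace ℂ 2 p)
    (isClosedImmersion_fiberι_familySpz_toProjectiveSpace ℂ 2 p (cyclicCoverSpz p)) Good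
    (fun s t₁ N hN T₁ _ ↦ by
      obtain ⟨W₀, hW₀o, ht₁W₀, hW₀N, hW₀pc, ψ, ⟨hψa, hψs, hψy⟩, hW₀ψ, r₂, w₂, hw₂, hhol⟩ :=
        exists_topFormFrame_familySpz_chartAt 1 p (cyclicCoverSpz p) (by omega) m
          (isSmoothProjectiveFamily_cyclicCoverFamily p) (cyclicCoverFamily_locallyTrivial p) A hA s t₁ N hN T₁
      exact ⟨W₀, hW₀o, ht₁W₀, hW₀N, hW₀pc, ψ, ⟨t₁.1, hψa, hψs, hψy⟩, hW₀ψ, r₂, w₂, hw₂, hhol⟩)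
  -- the coefficient chart
  let χ : ComplexPoints S → (TernaryIndex p → ℂ) := fun t e => (branchForm p t).coeff e.1
  have hχ : Topology.IsEmbedding χ := isEmbedding_coeffChart p
  refine ⟨{0} ∪ ⋃ Z ∈ 𝒞, χ '' (Subtype.val '' Z), ?_, ?_, Or.inl rfl, ?_⟩
  · -- meagre
    refine (isMeagre_singleton_zero p).union (isMeagre_biUnion h𝒞c fun Z hZ ↦ ?_)
    exact hχ.isInducing.isMeagre_image
      (Topology.IsInducing.subtypeVal.isMeagre_image (h𝒞s Z hZ).2.isMeagre)
  · -- null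
    haveI : Nonempty (TernaryIndex p) := ⟨⟨Finsupp.single 0 p, by rw [Finsupp.degree_single]⟩⟩
    rw [measure_union_null_iff]
    refine ⟨measure_singleton _, (measure_biUnion_null_iff h𝒞c).2 fun Z hZ ↦ ?_⟩
    obtain ⟨⟨W', ψ, g, ⟨t₁, hψa, hψs, hψy⟩, hW'o, hW'pc, hW'ψ, hg, hne, rfl⟩, -⟩ := h𝒞s Z hZ
    set c := ComplexPoints.algebraicChart S m t₁ with hc
    -- the image lies in `F '' {z ∈ ψ(W') | g z = 0}`, `F = χ ∘ c⁻¹`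
    have hsub : χ '' (Subtype.val '' {t | t ∈ W' ∧ g (ψ t) = 0}) ⊆
        (fun z ↦ χ (c.symm z)) '' {z ∈ ψ '' W' | g z = 0} := by
      rintro _ ⟨_, ⟨t, ht, rfl⟩, rfl⟩
      refine ⟨ψ t, ⟨Set.mem_image_of_mem _ ht.1, ht.2⟩, ?_⟩
      change χ (c.symm (ψ t)) = χ t.1
      rw [← hψy, ψ.left_inv (hW'ψ ht.1)]
    refine measure_mono_null hsub ?_
    have hUo : IsOpen (ψ '' W') := ψ.isOpen_image_of_subset_source hW'o hW'ψ
    have hUc : IsConnected (ψ '' W') := (hW'pc.image' (ψ.continuousOn.mono hW'ψ)).isConnected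
    have hUT : ψ '' W' ⊆ c.target := by
      rintro _ ⟨t, ht, rfl⟩
      rw [hψa t]
      exact c.map_source ((hψs t).1 (hW'ψ ht))
    have hne' : ∃ z ∈ ψ '' W', g z ≠ 0 := by
      obtain ⟨t', ht', hne⟩ := hne
      exact ⟨ψ t', Set.mem_image_of_mem _ ht', hne⟩
    exact volume_image_zeroSet_eq_zero (T := TernaryIndex p) (by rw [hmdef, Nat.card_eq_fintype_card, zero_add])
      hUo hUc (fun z hz ↦ (hg z hz).restrictScalars) hne'
      (((differentiableOn_coeffChart_comp_algebraicChart_symm p m t₁).mono hUT).restrictScalars ℝ)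
  · -- genericity off `M`
    intro f hf hJ hfM
    refine hgen _ fun hmem ↦ hfM (Or.inr ?_)
    obtain ⟨Z, hZ, htZ⟩ := Set.mem_sUnion.1 hmem
    refine Set.mem_biUnion hZ ⟨cyclicCoverPoint p f, ⟨_, htZ, rfl⟩, funext fun e ↦ ?_⟩
    exact coeffChart_cyclicCoverPoint hf hJ e

/-! ### §2 Analytic K1-A — almost everywhere, unconditional -/

/-- **Analytic K1-A, almost everywhere, unconditionally** (§2): for every prime `p ≥ 7` a set `M ⊆ ℂ^{TernaryIndex p}`,
meagre AND Lebesgue-null, such that every `f` homogeneous of degree `p` with coefficient vector off `M` and every smooth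
projective `X ⊂ ℙ³` cut out by `x₃^p − f` carry `σ : X ⟶ X` with the route's clauses `Deck ∧ Comm` (verbatim the
`let`-block of the route decl `VeryGeneralDeckCommutatorsInHg`; the statement of `exists_deck_comm_offMeagre` with the
extra conjunct `volume M = 0`). [cite: Deligne1972WeilK3, Prop. 7.5] [cite: Andre1992, §4 Lemma 4 and §5 Thm. 1]
[cite: CarlsonToledo1999, §6 (kdoublept) and §7 Theorem 7.1] [cite: VoisinHodgeII2003, §5.3.1 Lemma 5.13] -/
theorem exists_deck_comm_ae :
    open Literature.AlgebraicGeometry.Motives Literature.AlgebraicGeometry.HodgeTheory Literature.AlgebraicGeometry.HodgeTheory.BettiUniverse CategoryTheory.Limits in let pmul : List ℕ → List ℕ → List ℕ := fun a b => (List.range (a.length + b.length - 1)).map fun k => ((List.range (k + 1)).map fun i => a.getD i 0 * b.getD (k - i) 0).sum; let ehn : ℕ → ℕ → ℕ → ℕ := fun p j q => if (q + 1) * p < 3 + j then 0 else ((List.replicate 3 (List.replicate (p - 1) 1)).foldl pmul [1]).getD ((q + 1) * p - 3 - j) 0; let Deck : (p : ℕ) → (X : SchemeOver ℂ) → IsSmoothProjective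 2 X → (X ⟶ X) → Prop := fun p X hX σ => pull σ 2 ^ p = 1 ∧ (∀ x y, tr hX (2 + 2) (cup X 2 2 (pull σ 2 x) (pull σ 2 y)) = tr hX (2 + 2) (cup X 2 2 x y)) ∧ Module.finrank ℚ ↥(Module.End.eigenspace (pull σ 2) 1) = 1 ∧ ∃ ζ : ℂ, IsPrimitiveRoot ζ p ∧ ∀ j q : ℕ, 1 ≤ j → j < p → q ≤ 2 → Module.finrank ℂ ↥(Module.End.eigenspace ((pull σ 2).baseChange ℂ) (ζ ^ j) ⊓ (hodge exists_isReal_hodgeModel_holds hX 2).piece ((2 : ℤ) - q) q) = ehn p j q; let Uni : (X : SchemeOver ℂ) → IsSmoothProjective 2 X → (X ⟶ X) → (bettiCohomology X 2 ≃ₗ[ℚ] bettiCohomology X 2) → Prop := fun X hX σ g => (∀ x, g (pull σ 2 x) = pull σ 2 (g x)) ∧ ∀ x y, tr hX (2 + 2) (cup X 2 2 (g x) (g y)) = tr hX (2 + 2) (cup X 2 2 x y); let Comm : (X : SchemeOver ℂ) → IsSmoothProjective 2 X → (X ⟶ X) → Prop := fun X hX σ => haveI := finite hX 2; haveI : HodgeTensorFacts.{0,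 0} := hodgeTensorFacts_holds; ∀ g h : bettiCohomology X 2 ≃ₗ[ℚ] bettiCohomology X 2, Uni X hX σ g → Uni X hX σ h → g * h * g⁻¹ * h⁻¹ ∈ (hodge exists_isReal_hodgeModel_holds hX 2).hodgeGroup; ∀ ⦃p : ℕ⦄, p.Prime → 7 ≤ p → ∃ M : Set ({d : Fin 3 →₀ ℕ // d.degree = p} → ℂ), IsMeagre M ∧ MeasureTheory.volume M = 0 ∧ ∀ f : MvPolynomial (Fin 3) ℂ, f.IsHomogeneous p → (fun d : {d : Fin 3 →₀ ℕ // d.degree = p} => f.coeff d.1) ∉ M → ∀ ⦃X : SchemeOver ℂ⦄ (hX : IsSmoothProjective 2 X), IsHypersurfaceCutOutBy 3 (MvPolynomial.X (Fin.last 3) ^ p - MvPolynomial.rename Fin.castSucc f) X → ∃ σ : X ⟶ X, Deck p X hX σ ∧ Comm X hX σ := by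
  intro pmul ehn Deck Uni Comm p hp h7
  haveI : NeZero p := ⟨hp.ne_zero⟩
  have hp2 : 2 ≤ p := by omega
  -- real (hence Hodge-symmetric) Hodge models of the fibres of the Carlson–Toledo family
  have hAm := fun t : ComplexPoints (cyclicCoverBase p) =>
    exists_isReal_hodgeModel_holds.exists_isHodgeSymmetric
      ((isSmoothProjectiveFamily_cyclicCoverFamily p).isSmoothProjective t)
  let A : ∀ t : ComplexPoints (cyclicCoverBase p), HodgeModel 2 (fiberOver (cyclicCoverFamily p) t) :=
    fun t => (hAm t).choose
  have hA : ∀ t, (A t).IsHodgeSymmetric := fun t => (hAm t).choose_spec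
  obtain ⟨M, hM, hM0, h0M, hgen⟩ := exists_nullMeagre_isHodgeGenericPoint_cyclicCoverFamily p (by omega) A hA
  refine ⟨M, hM, hM0, fun f hf hfM X hX hcut => ?_⟩
  have hf0 : f ≠ 0 := by
    intro h
    apply hfM
    have : (fun d : TernaryIndex p => f.coeff d.1) = 0 := funext fun d => by rw [h, MvPolynomial.coeff_zero]; rfl
    rw [this]
    exact h0M
  obtain ⟨e⟩ := hcut.nonempty_iso_hypersurface
  have hXF : IsSmoothProjective 2 (SmoothHypersurface.hypersurface
      (MvPolynomial.X (Fin.last 3) ^ p - MvPolynomial.rename Fin.castSucc f)) := hX.of_iso e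
  have hJ : SmoothHypersurface.IsNonsingularForm ℂ (cyclicCoverForm p f) :=
    CyclicCoverFormNonsingular.isNonsingularForm_cyclicCoverForm_of_isSmoothProjective hp2 hf hf0 hXF
  exact exists_deck_comm_of_hodgeGeneric_of_localMonodromyBound
    carlsonToledo1999_nodalMeridianLocalMonodromyBound_holds hp h7 f hf hf0 hXF A hA (hgen f hf hJ hfM) hX hcut

/-! ### §3 The analytic leaf — almost everywhere, unconditional -/

/-- **Analytic rung-F-H1 leaf, almost everywhere, unconditionally** (§3): for every prime `p ≥ 7` a subset `M` of the
coefficient space `ℂ^{TernaryIndex p}` with `volume M = 0` and `M` meagre such that for every `f` homogeneous of degree `p`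
with coefficient vector off `M`, every smooth projective surface `X ⊂ ℙ³` cut out by `x₃^p − f` and every `(k+1)`-fold
self fibre power `Y` of `X`: `HodgeConjectureFor (2(k+1)) Y` — the Hodge conjecture for all powers of Lebesgue-almost-every
`p`-cyclic surface. Items 19544 ∕ 19543 stay open (they ask for a countable union of proper Zariski-closed exceptional
sets, CDK); rung F-H1 not moved; HC not proved. [cite: Deligne1972WeilK3, Prop. 7.5] [cite: Andre1992, §4 Lemma 4 and §5 Thm. 1]
[cite: CarlsonToledo1999, §6 (kdoublept) and §7 Theorem 7.1] [cite: VoisinHodgeII2003, §5.3.1 Lemma 5.13]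
[cite: Griffiths1968PeriodsII, Thm. 1.1] -/
theorem cyclicSurfacePowersHodge_ae :
    ∀ ⦃p : ℕ⦄, p.Prime → 7 ≤ p → ∃ M : Set ({d : Fin 3 →₀ ℕ // d.degree = p} → ℂ), MeasureTheory.volume M = 0 ∧ IsMeagre M ∧
      ∀ f : MvPolynomial (Fin 3) ℂ, f.IsHomogeneous p →
        (fun d : {d : Fin 3 →₀ ℕ // d.degree = p} => f.coeff d.1) ∉ M →
        ∀ ⦃X : SchemeOver ℂ⦄, IsSmoothProjective 2 X →
          IsHypersurfaceCutOutBy 3 (MvPolynomial.X (Fin.last 3) ^ p - MvPolynomial.rename Fin.castSucc f) X →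
          ∀ ⦃k : ℕ⦄ ⦃Y : SchemeOver ℂ⦄, (∃ π : Fin (k + 1) → (Y ⟶ X), Nonempty (IsLimit (Fan.mk Y π))) →
            HodgeConjectureFor (2 * (k + 1)) Y := by
  intro p hp h7
  haveI : NeZero p := ⟨hp.ne_zero⟩
  have hp2 : 2 ≤ p := by omega
  have hAm := fun t : ComplexPoints (cyclicCoverBase p) =>
    exists_isReal_hodgeModel_holds.exists_isHodgeSymmetric
      ((isSmoothProjectiveFamily_cyclicCoverFamily p).isSmoothProjective t)
  let A : ∀ t : ComplexPoints (cyclicCoverBase p), HodgeModel 2 (fiberOver (cyclicCoverFamily p) t) :=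
    fun t => (hAm t).choose
  have hA : ∀ t, (A t).IsHodgeSymmetric := fun t => (hAm t).choose_spec
  obtain ⟨M, hM, hM0, h0M, hgen⟩ := exists_nullMeagre_isHodgeGenericPoint_cyclicCoverFamily p (by omega) A hA
  refine ⟨M, hM0, hM, fun f hf hfM X hX hcut k Y hY => ?_⟩
  have hf0 : f ≠ 0 := by
    intro h
    apply hfM
    have : (fun d : TernaryIndex p => f.coeff d.1) = 0 := funext fun d => by rw [h, MvPolynomial.coeff_zero]; rfl
    rw [this]
    exact h0M
  obtain ⟨e⟩ := hcut.nonempty_iso_hypersurface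
  have hXF : IsSmoothProjective 2 (SmoothHypersurface.hypersurface
      (MvPolynomial.X (Fin.last 3) ^ p - MvPolynomial.rename Fin.castSucc f)) := hX.of_iso e
  have hJ : SmoothHypersurface.IsNonsingularForm ℂ (cyclicCoverForm p f) :=
    CyclicCoverFormNonsingular.isNonsingularForm_cyclicCoverForm_of_isSmoothProjective hp2 hf hf0 hXF
  exact hodgeConjectureFor_powers_of_hodgeGeneric_of_localMonodromyBound
    carlsonToledo1999_nodalMeridianLocalMonodromyBound_holds hp h7 f hf hf0 hXF A hA (hgen f hf hJ hfM) hX hcut hY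

end Summit.HodgeConjecture.HodgeConjecture.Theorems.CyclicUnitaryPowersGenericCyclicSurfacePowersHodge

end
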